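import Summits.BirchSwinnertonDyer.BirchSwinnertonDyer.Theorems.RamifiedSevenEllipticUnitsLemmaXiAvatarNorm
import Literature.NumberTheory.GaloisRepresentations.CMTypeHeckeCharacter
import Literature.NumberTheory.GaloisRepresentations.HeckeCharacterWeakApproximation
import Summits.BirchSwinnertonDyer.Rank1Residual.X11b.FramePrincipalUnitPowers
import HarnessLib

set_option linter.dupNamespace false
set_option autoImplicit false

/-!
# Lemma Ξ, kernel side (II): `η ∘ c = η` — the de Rham generator is `ξ₁ = φ(φ∘c)⁻¹` on the nose
# (clause (P1) of the Rubin package), and clause (P5) from the values of `φ(φ∘c)⁻¹`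

Helper file for the K7r Value crux `EllipticUnitValueSevenOfGZK` (stmt-BirchSwinnertonDyer-19945), line
`rubin-formula-zp` v4, stub `stub_rubinPackageSevenZp` (`X12.O11.RamifiedCMRubinPackageAtZp W 7 (-11)`):
clauses (P1) `R.ξ = φ(φ∘c)⁻¹` and (P5) `‖avatarValueAt R.r γ − 1‖² = p⁻¹`.
**LEMMA Ξ** (cell bsd-cm, planner g21 03:54:59Z; typing layer rev 4 of
`BurungaleKobayashiNakamuraOta2026/RubinPadicLFunction`, which exposes [BKNO]'s finite-order character
`η` with `η_pow_eq_one : ∃ m, 0 < m ∧ ¬ p ∣ m ∧ η ^ m = 1` and the definition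
`ξ_eq : ξ = φ(φ∘c)⁻¹ · (η(η∘c)⁻¹)⁻¹`, and proves `ξ_eq_of_galConj_η_eq : η∘c = η → ξ = φ(φ∘c)⁻¹`).
We prove `RubinPadicLFunctionData.galConj_η_eq : HeckeCharacter.galConj c R.η = R.η` for EVERY number
field `K : Type`, prime `p`, `ℤ_p`-extension `κ`, automorphism `c`, under ONE value-level hypothesis
on `φ_ac := φ(φ∘c)⁻¹`: outside a finite set of finite places, `φ_ac` is unramified at `v` and
`ι⁻¹(φ_ac(ϖ_v)) ∈ ℚ̄_p` is a principal unit (`‖· − 1‖ < 1` in `ℂ_p`) — for `K = ℚ(√−7)`, `p = 7`,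
`φ = ψ_E` (`E/ℚ` CM): `α/ᾱ ≡ 1 (mod √−7)` for `(α) = v ∤ 7` (`c` acts trivially on `𝒪_K/𝔭 = 𝔽_7`).

The proof uses NO class field theory, no `ℤ_p`-rank statement and no tameness: with
`θ := η(η∘c)⁻¹` (`θ^m = 1`, `p ∤ m`, `ξ = φ_ac θ⁻¹`): (1) `r = r̂₁` factors through `κ : Γ_K ↠ ℤ_p`,
so `r̂(σ)^{pⁿ} = g((κσ)^{pⁿ}) → g(1) = 1` for EVERY `σ` (`g` the continuous descent of `r̂` along the
quotient map `κ`; `pⁿ a → 0` in `ℤ_p`); (2) at an arithmetic Frobenius `σ_v` (`v ∤ p`, `ξ`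
unramified) `r̂(σ_v) = Y⁻¹ Z`, `Y = ι⁻¹(φ_ac(ϖ_v))` a principal unit, `Z = ι⁻¹(θ(ϖ_v))`, `Z^m = 1`;
(3) principal units satisfy `W^{pⁿ} → 1` (`‖a^p − 1‖ ≤ ‖a − 1‖ · max(‖p‖, ‖a − 1‖)`), so
`Z^{pⁿ} → 1`; a root of unity of order prime to `p` within distance `< 1` of `1` IS `1`
(`‖1 + ζ + ⋯ + ζ^{m−1}‖ = ‖m‖ = 1`), so `Z^{pⁿ} = 1` for large `n` and `gcd(pⁿ, m) = 1` gives `Z = 1`: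
`θ(ϖ_v) = 1` for almost all `v`; (4) GL(1) rigidity (tree theorem
`HeckeCharacter.eq_one_of_eventually_valueAtUniformizer_eq_one`, Cassels–Fröhlich VII Prop. 4.1):
`θ = 1`, i.e. `η∘c = η`.

Corollaries: `RubinPadicLFunctionData.ξ_eq_φac` ((P1)) and
`RubinPadicLFunctionData.norm_avatarValueAt_sub_one_sq_eq_of_φac` ((P5) from the values of `φ_ac`, via
file (I) `…LemmaXiAvatarNorm`). References: [BKNO] arXiv:2608.06879, Def. 4.2, proof of Prop. 3.7 (2);
Cassels–Fröhlich (1967), Ch. VII §4 Prop. 4.1; Washington, *Cyclotomic Fields*, §§5.1, 13.1.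
-/

noncomputable section
open scoped Classical NNReal Topology
open Filter NumberField IsDedekindDomain Field Polynomial
  Literature.NumberTheory.EllipticCurves
  Literature.NumberTheory.EllipticCurves.BurungaleKobayashiNakamuraOta2026
  Literature.NumberTheory.GaloisRepresentations

namespace Summit.BirchSwinnertonDyer.BirchSwinnertonDyer.Theorems.RamifiedSevenEllipticUnits

namespace LemmaXi

variable {p : ℕ} [hp : Fact p.Prime]

/-! ## §1 Principal units and roots of unity in `ℂ_p` -/

/-- The geometric sum at a principal unit: `‖1 + a + ⋯ + a^{m−1}‖ ≤ max ‖m‖ ‖a − 1‖`. [folklore] -/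
theorem norm_geom_sum_le {a : ℂ_[p]} (h : ‖a - 1‖ ≤ 1) (m : ℕ) :
    ‖∑ i ∈ Finset.range m, a ^ i‖ ≤ max ‖(m : ℂ_[p])‖ ‖a - 1‖ := by
  have hsplit : ∑ i ∈ Finset.range m, a ^ i = (∑ i ∈ Finset.range m, (a ^ i - 1)) + (m : ℂ_[p]) := by
    rw [Finset.sum_sub_distrib, Finset.sum_const, Finset.card_range, nsmul_eq_mul, mul_one,
      sub_add_cancel]
  have hsmall : ‖∑ i ∈ Finset.range m, (a ^ i - 1)‖ ≤ ‖a - 1‖ :=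
    IsUltrametricDist.norm_sum_le_of_forall_le_of_nonneg (norm_nonneg _)
      fun i _ ↦ norm_pow_sub_one_le h i
  rw [hsplit]
  exact (IsUltrametricDist.norm_add_le_max _ _).trans (max_le_max_right _ hsmall |>.trans_eq
    (max_comm _ _))

/-- One `p`-th power step: `‖a^p − 1‖ ≤ ‖a − 1‖ · max ‖p‖ ‖a − 1‖` for `‖a − 1‖ ≤ 1`.
[cite: Washington1997, §5.1] -/
theorem norm_pow_prime_sub_one_le {a : ℂ_[p]} (h : ‖a - 1‖ ≤ 1) :
    ‖a ^ p - 1‖ ≤ ‖a - 1‖ * max ‖(p : ℂ_[p])‖ ‖a - 1‖ := by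
  rw [← geom_sum_mul, norm_mul, mul_comm]
  exact mul_le_mul_of_nonneg_left (norm_geom_sum_le h p) (norm_nonneg _)

/-- Iterated: `‖w^{pⁿ} − 1‖ ≤ ‖w − 1‖ · (max ‖p‖ ‖w − 1‖)ⁿ` for `‖w − 1‖ ≤ 1`.
[cite: Washington1997, §5.1] -/
theorem norm_pow_prime_pow_sub_one_le {w : ℂ_[p]} (h : ‖w - 1‖ ≤ 1) (n : ℕ) :
    ‖w ^ (p ^ n) - 1‖ ≤ ‖w - 1‖ * (max ‖(p : ℂ_[p])‖ ‖w - 1‖) ^ n := by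
  induction n with
  | zero => simp
  | succ n ih =>
    -- `‖p‖ < 1` in `ℂ_p` is the tree's `Literature.NumberTheory.EllipticCurves.norm_prime_padicComplex_lt_one`
    have hp1 : ‖(p : ℂ_[p])‖ < 1 := by
      rw [Summit.BirchSwinnertonDyer.Rank1Residual.X11b.R1.norm_natCast_padicComplex]
      exact Padic.norm_natCast_lt_one_iff.mpr dvd_rfl
    have hq1 : max ‖(p : ℂ_[p])‖ ‖w - 1‖ ≤ 1 := max_le hp1.le h
    have hqn : (max ‖(p : ℂ_[p])‖ ‖w - 1‖) ^ n ≤ 1 := pow_le_one₀ (by positivity) hq1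
    have ha : ‖w ^ (p ^ n) - 1‖ ≤ ‖w - 1‖ := ih.trans (by
      calc ‖w - 1‖ * (max ‖(p : ℂ_[p])‖ ‖w - 1‖) ^ n ≤ ‖w - 1‖ * 1 := by gcongr
        _ = ‖w - 1‖ := mul_one _)
    have ha1 : ‖w ^ (p ^ n) - 1‖ ≤ 1 := ha.trans h
    rw [pow_succ, pow_mul]
    refine (norm_pow_prime_sub_one_le ha1).trans ?_
    calc ‖w ^ p ^ n - 1‖ * max ‖(p : ℂ_[p])‖ ‖w ^ p ^ n - 1‖
        ≤ (‖w - 1‖ * (max ‖(p : ℂ_[p])‖ ‖w - 1‖) ^ n) * max ‖(p : ℂ_[p])‖ ‖w - 1‖ := by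
          gcongr
      _ = ‖w - 1‖ * (max ‖(p : ℂ_[p])‖ ‖w - 1‖) ^ (n + 1) := by ring

/-- **Principal units are `p`-adically contracted by `p`-th powers**: `‖w − 1‖ < 1 ⇒ w^{pⁿ} → 1` in
`ℂ_p`. [cite: Washington1997, §5.1] -/
theorem tendsto_pow_prime_pow_of_norm_sub_one_lt_one {w : ℂ_[p]} (h : ‖w - 1‖ < 1) :
    Tendsto (fun n : ℕ ↦ w ^ (p ^ n)) atTop (𝓝 1) := by
  have hp1 : ‖(p : ℂ_[p])‖ < 1 := by
    rw [Summit.BirchSwinnertonDyer.Rank1Residual.X11b.R1.norm_natCast_padicComplex]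
    exact Padic.norm_natCast_lt_one_iff.mpr dvd_rfl
  have hq : max ‖(p : ℂ_[p])‖ ‖w - 1‖ < 1 := max_lt hp1 h
  have hq0 : 0 ≤ max ‖(p : ℂ_[p])‖ ‖w - 1‖ := le_max_of_le_right (norm_nonneg _)
  have hgeom : Tendsto (fun n : ℕ ↦ ‖w - 1‖ * (max ‖(p : ℂ_[p])‖ ‖w - 1‖) ^ n) atTop (𝓝 0) := by
    have := (tendsto_pow_atTop_nhds_zero_of_lt_one hq0 hq).const_mul ‖w - 1‖
    rwa [mul_zero] at this
  rw [tendsto_iff_norm_sub_tendsto_zero]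
  exact squeeze_zero (fun n ↦ norm_nonneg _) (fun n ↦ norm_pow_prime_pow_sub_one_le h.le n) hgeom

/-- **A root of unity of order prime to `p` within distance `< 1` of `1` is `1`** (`ℂ_p`):
`‖z^m − 1‖ = ‖z − 1‖` for `p ∤ m` (`Rank1Residual.X11b.R1.norm_pow_sub_one_of_coprime`: the cofactor
`1 + z + ⋯ + z^{m−1}` has norm `‖m‖ = 1`). [cite: Serre1973, Ch. II §3.1] -/
theorem eq_one_of_pow_eq_one_of_norm_sub_one_lt_one {z : ℂ_[p]} {m : ℕ} (hpm : ¬ p ∣ m)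
    (hz : z ^ m = 1) (h : ‖z - 1‖ < 1) : z = 1 := by
  have := Summit.BirchSwinnertonDyer.Rank1Residual.X11b.R1.norm_pow_sub_one_of_coprime h
    ((Nat.Prime.coprime_iff_not_dvd hp.out).mpr hpm)
  rw [hz, sub_self, norm_zero] at this
  exact sub_eq_zero.mp (norm_eq_zero.mp this.symm)

/-- `z^{pⁿ} = 1` and `z^m = 1` with `p ∤ m` force `z = 1` (any monoid). [folklore] -/
theorem eq_one_of_pow_prime_pow_eq_one_of_pow_eq_one {M : Type*} [Monoid M] {z : M} {n m : ℕ}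
    (hpm : ¬ p ∣ m) (h1 : z ^ (p ^ n) = 1) (h2 : z ^ m = 1) : z = 1 := by
  have hcop : Nat.Coprime (p ^ n) m := .pow_left n ((Nat.Prime.coprime_iff_not_dvd hp.out).mpr hpm)
  have hd := Nat.dvd_gcd (orderOf_dvd_of_pow_eq_one h1) (orderOf_dvd_of_pow_eq_one h2)
  rw [hcop.gcd_eq_one, Nat.dvd_one] at hd
  exact orderOf_eq_one_iff.mp hd

/-- **Limit form**: if `ζ^m = 1` with `p ∤ m` and `ζ^{pⁿ} → 1` in `ℂ_p`, then `ζ = 1`. [folklore] -/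
theorem eq_one_of_tendsto_pow_prime_pow {ζ : ℂ_[p]} {m : ℕ} (hpm : ¬ p ∣ m) (hζ : ζ ^ m = 1)
    (ht : Tendsto (fun n : ℕ ↦ ζ ^ (p ^ n)) atTop (𝓝 1)) : ζ = 1 := by
  have hnorm : Tendsto (fun n : ℕ ↦ ‖ζ ^ (p ^ n) - 1‖) atTop (𝓝 0) :=
    tendsto_iff_norm_sub_tendsto_zero.mp ht
  obtain ⟨n, hn⟩ := (hnorm.eventually_lt_const zero_lt_one).exists
  have hn' : (ζ ^ (p ^ n)) ^ m = 1 := by rw [← pow_mul, mul_comm, pow_mul, hζ, one_pow]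
  have h1 : ζ ^ (p ^ n) = 1 := eq_one_of_pow_eq_one_of_norm_sub_one_lt_one hpm hn' hn
  exact eq_one_of_pow_prime_pow_eq_one_of_pow_eq_one hpm h1 hζ

/-! ## §2 A character of `Γ = Γ_K / ker κ ≅ ℤ_p` is `p`-adically contracting: `r̂(σ)^{pⁿ} → 1` -/

section Descent

variable {K : Type*} [Field K] [CharZero K]

/-- **Continuous descent along `κ`.** If `r` factors through the `ℤ_p`-extension `κ : Γ_K ↠ ℤ_p`,
`r̂ = g ∘ κ` for a continuous `g : ℤ_p → ℂ_p` (`κ` is a quotient map: `Γ_K` compact, `ℤ_p`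
Hausdorff). [cite: Washington1997, §13.1] -/
theorem exists_continuous_descent {κ : ZpExtension K p} {r : FramedGaloisRep K (PadicAlgCl p) 1}
    (hfac : FactorsThroughZp κ r) :
    ∃ g : Multiplicative ℤ_[p] → ℂ_[p], Continuous g ∧
      ∀ τ : absoluteGaloisGroup K, g (κ τ) = avatarValueAt r τ := by
  let g : Multiplicative ℤ_[p] → ℂ_[p] := fun x ↦
    avatarValueAt r (Function.surjInv κ.surjective x)
  have hg : ∀ τ : absoluteGaloisGroup K, g (κ τ) = avatarValueAt r τ := fun τ ↦
    avatarValueAt_eq_of_apply_eq hfac (Function.surjInv_eq κ.surjective (κ τ))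
  have hκc : Continuous (κ : absoluteGaloisGroup K → Multiplicative ℤ_[p]) :=
    κ.toContinuousMonoidHom.continuous
  have hq : Topology.IsQuotientMap (κ : absoluteGaloisGroup K → Multiplicative ℤ_[p]) :=
    hκc.isClosedMap.isQuotientMap hκc κ.surjective
  refine ⟨g, ?_, hg⟩
  rw [hq.continuous_iff, show g ∘ (κ : absoluteGaloisGroup K → Multiplicative ℤ_[p]) =
    fun τ ↦ avatarValueAt r τ from funext hg]
  exact continuous_avatarValueAt r

/-- In `ℤ_p` (written multiplicatively): `x^{pⁿ} → 1`. [folklore] -/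
theorem tendsto_pow_prime_pow_multiplicative (x : Multiplicative ℤ_[p]) :
    Tendsto (fun n : ℕ ↦ x ^ (p ^ n)) atTop (𝓝 1) := by
  have hp1 : ‖(p : ℤ_[p])‖ < 1 := by
    rw [PadicInt.norm_p]; exact inv_lt_one_of_one_lt₀ (by exact_mod_cast hp.out.one_lt)
  have h0 : Tendsto (fun n : ℕ ↦ ((p : ℤ_[p]) ^ n) * Multiplicative.toAdd x) atTop (𝓝 0) := by
    simpa using (tendsto_pow_atTop_nhds_zero_of_norm_lt_one hp1).mul_const (Multiplicative.toAdd x)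
  have h1 : (fun n : ℕ ↦ x ^ (p ^ n)) =
      fun n ↦ Multiplicative.ofAdd (((p : ℤ_[p]) ^ n) * Multiplicative.toAdd x) := by
    funext n
    rw [← ofAdd_toAdd x, ← ofAdd_nsmul, toAdd_ofAdd, nsmul_eq_mul, Nat.cast_pow]
  rw [h1, ← ofAdd_zero]
  exact (continuous_ofAdd.tendsto 0).comp h0

/-- **`r̂(σ)^{pⁿ} → 1` for every `σ`** when `r` factors through a `ℤ_p`-extension `κ`:
`r̂(σ)^{pⁿ} = g((κσ)^{pⁿ})` and `(κσ)^{pⁿ} → 1` in `ℤ_p`. [cite: Washington1997, §13.1] -/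
theorem tendsto_avatarValueAt_pow_prime_pow {κ : ZpExtension K p}
    {r : FramedGaloisRep K (PadicAlgCl p) 1} (hfac : FactorsThroughZp κ r)
    (σ : absoluteGaloisGroup K) :
    Tendsto (fun n : ℕ ↦ avatarValueAt r σ ^ (p ^ n)) atTop (𝓝 1) := by
  obtain ⟨g, hgc, hg⟩ := exists_continuous_descent hfac
  have h1 : (fun n : ℕ ↦ avatarValueAt r σ ^ (p ^ n)) = fun n ↦ g ((κ σ) ^ (p ^ n)) := by
    funext n
    rw [← avatarValueAt_pow, ← hg, ← ZpExtension.coe_toContinuousMonoidHom, map_pow]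
  have hg1 : g 1 = 1 := by
    have := hg 1
    rwa [← ZpExtension.coe_toContinuousMonoidHom, map_one, avatarValueAt_one] at this
  rw [h1, ← hg1]
  exact (hgc.tendsto 1).comp (tendsto_pow_prime_pow_multiplicative (κ σ))

end Descent

/-! ## §3 Hecke-character bookkeeping: `galConj` of powers, values of powers -/

section Hecke

variable {K : Type} [Field K] [NumberField K]

/-- `galConj c 1 = 1`. [folklore] -/
theorem galConj_one_right (c : K ≃ₐ[ℚ] K) : HeckeCharacter.galConj c (1 : HeckeCharacter K) = 1 := by
  ext x; rfl

/-- `galConj c (χ ^ m) = (galConj c χ) ^ m`. [folklore] -/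
theorem galConj_pow (c : K ≃ₐ[ℚ] K) (χ : HeckeCharacter K) (m : ℕ) :
    HeckeCharacter.galConj c (χ ^ m) = HeckeCharacter.galConj c χ ^ m := by
  induction m with
  | zero => rw [pow_zero, pow_zero, galConj_one_right]
  | succ m ih => rw [pow_succ, pow_succ, HeckeCharacter.galConj_mul, ih]

/-- `(χ ^ m)(ϖ_v) = χ(ϖ_v) ^ m` (the case `m = 0` is the tree's
`Rank1Residual.X11b.Three.LambdaSupply.valueAtUniformizer_one'`, re-derived inline). [folklore] -/
theorem valueAtUniformizer_pow (χ : HeckeCharacter K) (m : ℕ) (v : HeightOneSpectrum (𝓞 K)) :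
    (χ ^ m).valueAtUniformizer v = χ.valueAtUniformizer v ^ m := by
  induction m with
  | zero =>
    rw [pow_zero, pow_zero]
    simp [HeckeCharacter.valueAtUniformizer, HeckeCharacter.localComponent_apply]
  | succ m ih => rw [pow_succ, pow_succ, HeckeCharacter.valueAtUniformizer_mul', ih]

/-- The finite places above `p` form a finite set. [folklore] -/
theorem finite_setOf_natCast_mem (p : ℕ) [Fact p.Prime] :
    {v : HeightOneSpectrum (𝓞 K) | ((p : ℕ) : 𝓞 K) ∈ v.asIdeal}.Finite := by
  have hp0 : (Ideal.span {((p : ℕ) : 𝓞 K)}) ≠ ⊥ := by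
    rw [Ne, Ideal.span_singleton_eq_bot]
    exact_mod_cast (Fact.out : p.Prime).ne_zero
  refine (Ideal.finite_factors hp0).subset fun v hv ↦ ?_
  simp only [Set.mem_setOf_eq] at hv ⊢
  rw [Ideal.dvd_span_singleton]
  exact hv

end Hecke

end LemmaXi

/-! ## §4 LEMMA Ξ on the typed datum: `η ∘ c = η`, (P1) and (P5) -/

section Datum

open LemmaXi

variable {W : WeierstrassCurve ℚ} [W.IsElliptic] {p : ℕ} [hp : Fact p.Prime]
  {K : Type} [Field K] [NumberField K] {c : K ≃ₐ[ℚ] K} {𝔭 : HeightOneSpectrum (𝓞 K)}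
  {κ : ZpExtension K p} {γ : absoluteGaloisGroup K} {ι : PadicAlgCl p ≃+* ℂ} {φ : HeckeCharacter K}
  {Ω : ℂ} {𝓔 : AcDualExpSystem W p K 𝔭 κ ι} {D : EllipticUnitClassData W p K 𝔭 κ γ ι φ Ω 𝓔}

/-- **LEMMA Ξ: `η ∘ c = η`.** For a Rubin `p`-adic `L`-function datum `R` ([BKNO] Def. 4.7 with
Def. 4.2: `ξ₁ = φ_ac η_ac⁻¹`, `η` of finite order prime to `p`, `r₁` the avatar of `ξ₁` factoring
through `κ`), over ANY number field `K : Type`, prime `p`, `ℤ_p`-extension `κ` and `c ∈ Aut(K/ℚ)`: if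
outside a finite set of finite places `φ_ac = φ(φ∘c)⁻¹` is unramified at `v` with `ι⁻¹(φ_ac(ϖ_v))` a
principal unit of `ℂ_p` (`‖· − 1‖ < 1`), then `HeckeCharacter.galConj c R.η = R.η` (so `η_ac = 𝟙`).
Proof: §§1–3 and GL(1) rigidity `HeckeCharacter.eq_one_of_eventually_valueAtUniformizer_eq_one`.
[cite: BurungaleKobayashiNakamuraOta2026, Def. 4.2 and proof of Prop. 3.7 (2) (arXiv:2608.06879 pp. 20, 24) (claim; preprint; fields of the datum)]
[cite: CasselsFrohlichANT1967, Ch. VII §4 Prop. 4.1 (proof)] -/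
theorem RubinPadicLFunctionData.galConj_η_eq (R : RubinPadicLFunctionData W p K c 𝔭 κ γ ι φ Ω 𝓔 D)
    (hφ : ∃ S : Set (HeightOneSpectrum (𝓞 K)), S.Finite ∧ ∀ v ∉ S,
      (φ * (HeckeCharacter.galConj c φ)⁻¹).IsUnramifiedAt v ∧
        ‖((ι.symm ((φ * (HeckeCharacter.galConj c φ)⁻¹).valueAtUniformizer v) : PadicAlgCl p) :
          ℂ_[p]) - 1‖ < 1) :
    HeckeCharacter.galConj c R.η = R.η := by
  obtain ⟨m, hm0, hpm, hηm⟩ := R.η_pow_eq_one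
  -- notation: `φac = φ(φ∘c)⁻¹`, `θ = η(η∘c)⁻¹`
  set φac : HeckeCharacter K := φ * (HeckeCharacter.galConj c φ)⁻¹ with hφac
  set θ : HeckeCharacter K := R.η * (HeckeCharacter.galConj c R.η)⁻¹ with hθ
  have hθm : θ ^ m = 1 := by
    rw [hθ, mul_pow, inv_pow, ← galConj_pow, hηm, galConj_one_right, inv_one, mul_one]
  have hξ : R.ξ = φac * θ⁻¹ := by rw [hφac, hθ]; exact R.ξ_eq
  -- it suffices that `θ = 1`
  suffices hθ1 : θ = 1 by
    have := mul_inv_eq_one.mp (hθ ▸ hθ1 : R.η * (HeckeCharacter.galConj c R.η)⁻¹ = 1)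
    exact this.symm
  -- the exceptional set: `S`, the ramification of `ξ`, the places above `p`
  obtain ⟨S, hS, hS'⟩ := hφ
  have h1 : ∀ᶠ v in cofinite, v ∉ S := hS.compl_mem_cofinite
  have h2 : ∀ᶠ v : HeightOneSpectrum (𝓞 K) in cofinite, R.ξ.IsUnramifiedAt v :=
    R.ξ.finite_ramifiedPlaces_iff.1 (HeckeCharacter.finite_ramifiedPlaces_holds R.ξ)
  have h3 : ∀ᶠ v : HeightOneSpectrum (𝓞 K) in cofinite, ((p : ℕ) : 𝓞 K) ∉ v.asIdeal :=
    (finite_setOf_natCast_mem (K := K) p).compl_mem_cofinite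
  refine HeckeCharacter.eq_one_of_eventually_valueAtUniformizer_eq_one
    (((h1.and h2).and h3).mono fun v ⟨⟨hvS, hunr⟩, hpv⟩ ↦ ?_)
  obtain ⟨hunrφ, hY⟩ := hS' v hvS
  -- a Frobenius at `v`
  obtain ⟨𝔓, h𝔓⟩ := HeightOneSpectrum.primesAbove_nonempty v
  obtain ⟨σ, hσ⟩ := HeightOneSpectrum.exists_isArithFrobAt_of_mem_primesAbove_holds h𝔓
  obtain ⟨-, hchar⟩ := R.r_avatar v hpv hunr
  -- `r̂(σ) = Y⁻¹ · Z`
  set Y : ℂ_[p] := ((ι.symm (φac.valueAtUniformizer v) : PadicAlgCl p) : ℂ_[p]) with hYdef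
  set Z : ℂ_[p] := ((ι.symm (θ.valueAtUniformizer v) : PadicAlgCl p) : ℂ_[p]) with hZdef
  have hval : R.ξ.valueAtUniformizer v = φac.valueAtUniformizer v * (θ.valueAtUniformizer v)⁻¹ := by
    rw [hξ, HeckeCharacter.valueAtUniformizer_mul', HeckeCharacter.valueAtUniformizer_inv']
  have hrσ : avatarValueAt R.r σ = Y⁻¹ * Z := by
    rw [avatarValueAt_eq_of_hasFrobCharpolyAt hchar h𝔓 hσ, hval, map_mul, map_inv₀, mul_inv, inv_inv,
      hYdef, hZdef]
    simp only [PadicComplex.coe_eq, map_mul, map_inv₀]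
  -- `Z^m = 1`
  have hθv1 : θ.valueAtUniformizer v ^ m = 1 := by
    rw [← valueAtUniformizer_pow, hθm]
    simp [HeckeCharacter.valueAtUniformizer, HeckeCharacter.localComponent_apply]
  have hZm : Z ^ m = 1 := by
    rw [hZdef, PadicComplex.coe_eq, ← map_pow, ← map_pow, hθv1, map_one, map_one]
  -- `Z^{pⁿ} → 1`
  have hY1 : ‖Y⁻¹ - 1‖ < 1 := by rw [norm_inv_sub_one_eq hY]; exact hY
  have hYt : Tendsto (fun n : ℕ ↦ (Y⁻¹) ^ (p ^ n)) atTop (𝓝 1) :=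
    tendsto_pow_prime_pow_of_norm_sub_one_lt_one hY1
  have hut : Tendsto (fun n : ℕ ↦ (Y⁻¹ * Z) ^ (p ^ n)) atTop (𝓝 1) := by
    have := tendsto_avatarValueAt_pow_prime_pow R.r_factors σ
    rwa [hrσ] at this
  have hY0 : Y ≠ 0 := fun h0 ↦ by
    rw [h0, zero_sub, norm_neg, norm_one] at hY; exact lt_irrefl _ hY
  have hZt : Tendsto (fun n : ℕ ↦ Z ^ (p ^ n)) atTop (𝓝 1) := by
    have h := (hut.mul ((hYt.inv₀ one_ne_zero)))
    rw [inv_one, mul_one] at h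
    refine h.congr fun n ↦ ?_
    rw [mul_pow, mul_comm ((Y⁻¹) ^ (p ^ n)) (Z ^ (p ^ n)), mul_assoc, mul_inv_cancel₀
      (pow_ne_zero _ (inv_ne_zero hY0)), mul_one]
  -- hence `Z = 1`, i.e. `θ(ϖ_v) = 1`
  have hZ1 : Z = 1 := eq_one_of_tendsto_pow_prime_pow hpm hZm hZt
  have hθv : ι.symm (θ.valueAtUniformizer v) = 1 := by
    apply UniformSpace.Completion.coe_injective (PadicAlgCl p)
    change Z = ((1 : PadicAlgCl p) : ℂ_[p])
    rw [hZ1, PadicComplex.coe_eq, map_one]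
  simpa using congrArg ι hθv

/-- **(P1) — the de Rham generator is `φ_ac` on the nose**: under the value hypothesis of
`galConj_η_eq`, `R.ξ = φ(φ∘c)⁻¹` (`ξ_eq_of_galConj_η_eq` of the typing layer).
[cite: BurungaleKobayashiNakamuraOta2026, Def. 4.2 (arXiv:2608.06879 p. 24) (claim; preprint; fields of the datum)] -/
theorem RubinPadicLFunctionData.ξ_eq_φac (R : RubinPadicLFunctionData W p K c 𝔭 κ γ ι φ Ω 𝓔 D)
    (hφ : ∃ S : Set (HeightOneSpectrum (𝓞 K)), S.Finite ∧ ∀ v ∉ S,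
      (φ * (HeckeCharacter.galConj c φ)⁻¹).IsUnramifiedAt v ∧
        ‖((ι.symm ((φ * (HeckeCharacter.galConj c φ)⁻¹).valueAtUniformizer v) : PadicAlgCl p) :
          ℂ_[p]) - 1‖ < 1) :
    R.ξ = φ * (HeckeCharacter.galConj c φ)⁻¹ :=
  R.ξ_eq_of_galConj_η_eq (RubinPadicLFunctionData.galConj_η_eq R hφ)

/-- **(P5) from the values of `φ_ac`**: if outside a finite set every finite place `v ∤ p` has
`φ_ac = φ(φ∘c)⁻¹` unramified with `‖ι⁻¹(φ_ac(ϖ_v)) − 1‖² ≤ p⁻¹` in `ℂ_p`, and one such place achieves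
equality, then `‖avatarValueAt R.r γ − 1‖² = p⁻¹` (`γ` a topological generator of `κ`): by (P1) the
values of `R.ξ` ARE those of `φ_ac`, and file (I) applies.
[cite: BurungaleKobayashiNakamuraOta2026, Def. 4.2 and Def. 4.7 (arXiv:2608.06879 pp. 24, 27) (claim; preprint; fields of the datum)] -/
theorem RubinPadicLFunctionData.norm_avatarValueAt_sub_one_sq_eq_of_φac [Fact (κ.IsTopGenerator γ)]
    (R : RubinPadicLFunctionData W p K c 𝔭 κ γ ι φ Ω 𝓔 D)
    (hall : ∃ S : Set (HeightOneSpectrum (𝓞 K)), S.Finite ∧ ∀ v ∉ S,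
      ((p : ℕ) : 𝓞 K) ∉ v.asIdeal ∧ (φ * (HeckeCharacter.galConj c φ)⁻¹).IsUnramifiedAt v ∧
        ‖((ι.symm ((φ * (HeckeCharacter.galConj c φ)⁻¹).valueAtUniformizer v) : PadicAlgCl p) :
          ℂ_[p]) - 1‖ ^ 2 ≤ ((p : ℝ))⁻¹)
    (hone : ∃ v : HeightOneSpectrum (𝓞 K), ((p : ℕ) : 𝓞 K) ∉ v.asIdeal ∧
      (φ * (HeckeCharacter.galConj c φ)⁻¹).IsUnramifiedAt v ∧
        ‖((ι.symm ((φ * (HeckeCharacter.galConj c φ)⁻¹).valueAtUniformizer v) : PadicAlgCl p) :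
          ℂ_[p]) - 1‖ ^ 2 = ((p : ℝ))⁻¹) :
    ‖avatarValueAt R.r γ - 1‖ ^ 2 = ((p : ℝ))⁻¹ := by
  have hp1 : ((p : ℝ))⁻¹ < 1 := inv_lt_one_of_one_lt₀ (by exact_mod_cast hp.out.one_lt)
  have hξ : R.ξ = φ * (HeckeCharacter.galConj c φ)⁻¹ := by
    obtain ⟨S, hS, hS'⟩ := hall
    exact RubinPadicLFunctionData.ξ_eq_φac R
      ⟨S, hS, fun v hv ↦ ⟨(hS' v hv).2.1, norm_lt_one_of_sq_le (hS' v hv).2.2 hp1⟩⟩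
  obtain ⟨S, hS, hS'⟩ := hall
  refine RubinPadicLFunctionData.norm_avatarValueAt_sub_one_sq_eq R ⟨S, hS, fun v hv ↦ ?_⟩ ?_
  · rw [hξ]; exact hS' v hv
  · rw [hξ]; exact hone

end Datum

end Summit.BirchSwinnertonDyer.BirchSwinnertonDyer.Theorems.RamifiedSevenEllipticUnits

end
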